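/-
Copyright: the b2b-balaban cell (near-miss cell 7), T⁴-continuum CRUX team (coordinator ruling e34b3e0c item (2)),
seat t4-ne7b-formalise-leaf-05 (gen 26), on the NE7b crux refuter's follow-up note (PRICING-NE7b v6 F28, seat
`t4-ne7b-refuter` gen 6). Released under the licence of the surrounding project.
-/
import Summits.QuantumFields.BalabanUV.T4Continuum.Spine.NE7b.HealingMapClassFibred

/-!
# Set-valued healing WITH AN ADDITIVE REMAINDER: the flux-coherent rest paid by a large-deviation bound
# (route NE7b R-H; refuter's PRICING-NE7b v6 F28 «(MP<L²) below the clause re-cut by FLUX COHERENCE»)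

Cell `pub-balaban`, sub-cell `t4`, spine estimate NE7b (node U5c), candidate route R-H «Peierls healing map». The
sibling `…NE7b.HealingMapClass` (`HealingMapClassFibred`) lands the (R-top) cut: every bad term is healed into a CLASS of
terms with `A ≤ q·Σ_{class} A` POINTWISE in the exterior field. The refuter's v6 F28 re-cuts the pointwise comparison
below the PH-k clause: exteriors whose flux-Morrey profile on the look-in collar is small keep the pointwise healing
comparison; the COHERENT rest (where the interior-free minimiser bifurcates, v5 F23b) is NOT compared but PAID by a
large-deviation bound. At the level of the finite sums this is exactly: «the healing law's pointwise inequality must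
carry an ADDITIVE DEFECT `a b ≤ q·Σ_{τ ∈ heal b} a τ + r b`, with the remainders' total small against the END's
tolerance» (refuter's reply to this seat, `CLAIMS.log` l.28800).

THIS FILE (≈ the refuter's «40 lines on top of §2», as a sibling because of the 400-line cap):
* §1 **`sum_le_mul_sum_add_of_healSet`** — `Σ_{Bad} a ≤ q·Σ_T a + Σ_{Bad} r` (the literal additive form; no sign
  condition on `r`); **`sum_le_sum_mul_sum_add_of_healSets`** — the cover over pinned components with the remainder
  counted ONCE per bad term (no multiplicity over the components containing it): `Σ_{Bad} a ≤ (Σ_x q x)·Σ_T a + Σ_{Bad} r`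
  (trick: cover the non-negative part `(a − r)⁺`, which still obeys the pure healing bound).
* §2 **`HealingLawsSetR`** — `HealingLawsSet` with `le_heal : A K t τ ≤ q K x·Σ_{heal} A K t τ' + rem K t τ` and the
  large-deviation budget in the RELATIVE currency the tree's `RelWeightBound` consumes:
  `sum_rem_le : Σ_{τ ∈ Bad K t} rem K t τ ≤ ρ K · Σ_{τ ∈ T K} A K t τ`, `0 ≤ ρ K` (for probability-normalised weights this
  is the refuter's «`Σ_{b ∈ Bad K} r b ≤ ρ K`»); `HealingLawsSetR.ofSet` (zero remainder); `HealingLawsSetR.bad_le`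
  (relative weight `≤ Σ_x q K x + ρ K`); **`relWeightBound_of_healingSetR`** (common majorant `W K ≥ Σ_x q + ρ K`, `W < 1`
  from `K₀` on, `Σ W < ∞` ⟹ `RelWeightBound`, early steps emptied); **`exists_relWeightBound_of_healingSetR_majorant`**
  — the two-rate majorant for the healed part PLUS a summable `ρ` ⟹ `∃ K₀, RelWeightBound …` with the tolerance
  `V·r^{K − j⋆(K)} + ρ K` («Λσ-term + ρ»).
* §3 **`exists_relWeightBound_of_healingSetR_countFibred`** — the same END fed by the POSITION-FIBRED count of
  `HealingMapClassFibred` (F20b) per run: tolerance `vol·(Λσ∕(1−Λσ))·(Λσ)^{K−j⋆(K)} + ρ₀ K`.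

HONEST FRAMING. [folklore] finite-sum bookkeeping; the flux-coherence reading, the large-deviation bound behind `ρ`, the
(R-top) value-level condition and H3's quotient are DISPLAYED hypotheses (fields), nothing of [Bałaban 1983–89] is
asserted or cited; one hypothesis-shape `structure … : Prop`, no `def … : Prop` fact, no `[cite:]`. (MP<L²) OPEN; R-H
KEEP-AS-CANDIDATE and R-P1 KEEP∕fund are the refuter's grades, unchanged by bookkeeping. BY-NAME EFFECT ON THE WALL
(`WALL-NE7b-P1.md` §2): NONE. NE7b (`T4WeightBudget.RelWeightBound`) NOT PRINTED, NOT PROVED; spine PROVED 0∕9; rung (B)+1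
on a FINITE torus T⁴ — NOT infinite volume, NOT the mass gap, NOT Clay. HONEST DEPENDENCY: continuum YM on T⁴ ⇐ BetaPertH
∧ nine spine estimates (0/9 proved); BetaPertH ⇐ (D1) ∧ (D4) ∧ CAP+tail; G-an2-4 gates asym, D1 and NE2/3/4. POLICY (ruling
e34b3e0c): crux-route work of item (2) under `Spine/NE7b/`, NOT a `T4Continuum/Support` leaf.
-/

set_option autoImplicit false

open Finset
open Literature.MathematicalPhysics.QuantumFieldTheory.Balaban1983to89
open Literature.MathematicalPhysics.QuantumFieldTheory.Balaban1983to89.T4WeightBudget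

namespace Summit.QuantumFields.BalabanUV.T4Continuum.NE7b.HealingMapClass

/-! ## §1 The set-valued healing inequality with an additive remainder -/

section Heal

variable {α β : Type*} [DecidableEq β]

/-- **SET-VALUED HEALING WITH AN ADDITIVE REMAINDER** (refuter's F28 shape): if every bad term satisfies
`a b ≤ q·Σ_{τ ∈ heal b} a τ + r b` (healing classes inside `T`, pairwise disjoint across `Bad`; `q ≥ 0`; `a ≥ 0` on `T`;
NO sign condition on `r`), then `Σ_{Bad} a ≤ q·Σ_T a + Σ_{Bad} r`. [folklore] -/
theorem sum_le_mul_sum_add_of_healSet (Bad T : Finset β) {a r : β → ℝ} (heal : β → Finset β) {q : ℝ}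
    (ha : ∀ b ∈ T, 0 ≤ a b) (hq : 0 ≤ q) (hmem : ∀ b ∈ Bad, heal b ⊆ T)
    (hdisj : (↑Bad : Set β).PairwiseDisjoint heal)
    (hle : ∀ b ∈ Bad, a b ≤ q * ∑ τ ∈ heal b, a τ + r b) :
    ∑ b ∈ Bad, a b ≤ q * ∑ b ∈ T, a b + ∑ b ∈ Bad, r b :=
  calc ∑ b ∈ Bad, a b ≤ ∑ b ∈ Bad, (q * ∑ τ ∈ heal b, a τ + r b) := Finset.sum_le_sum hle
    _ = q * ∑ τ ∈ Bad.biUnion heal, a τ + ∑ b ∈ Bad, r b := by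
        rw [Finset.sum_add_distrib, Finset.sum_biUnion hdisj, Finset.mul_sum]
    _ ≤ q * ∑ b ∈ T, a b + ∑ b ∈ Bad, r b :=
        add_le_add (mul_le_mul_of_nonneg_left
          (Finset.sum_le_sum_of_subset_of_nonneg (Finset.biUnion_subset.mpr hmem) fun b hb _ => ha b hb) hq) le_rfl

/-- The positive part `(a b − r b)⁺` of a remainder-corrected weight still obeys the PURE set-valued healing bound. -/
theorem posPart_le_of_le_add {ab rb S q : ℝ} (hq : 0 ≤ q) (hS : 0 ≤ S) (h : ab ≤ q * S + rb) :
    max (ab - rb) 0 ≤ q * S :=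
  max_le (by linarith) (mul_nonneg hq hS)

/-- **THE COVER WITH REMAINDERS COUNTED ONCE.** Bad class covered by the sub-classes `Badx x` of the pinned components
`x ∈ X`, each with its own set-valued healing (`heal x`, classes inside `T`, pairwise disjoint on `Badx x`, quotient
`q x ≥ 0`) and the remainder-corrected law `a b ≤ q x·Σ_{τ ∈ heal x b} a τ + r b` on `Badx x` — the remainder `r b` of a
term NOT depending on which component heals it; `a ≥ 0` everywhere (NO sign condition on `r`). Then
`Σ_{Bad} a ≤ (Σ_{x ∈ X} q x)·Σ_T a + Σ_{Bad} r`: the remainder is paid ONCE per bad term (cover the non-negative part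
`(a − r)⁺`, which obeys the pure bound, and add `r` back on `Bad` only). [folklore] -/
theorem sum_le_sum_mul_sum_add_of_healSets (X : Finset α) (Badx : α → Finset β) (heal : α → β → Finset β)
    (q : α → ℝ) {Bad T : Finset β} {a r : β → ℝ} (ha : ∀ b, 0 ≤ a b) (hcov : Bad ⊆ X.biUnion Badx)
    (hq : ∀ x ∈ X, 0 ≤ q x) (hmem : ∀ x ∈ X, ∀ b ∈ Badx x, heal x b ⊆ T)
    (hdisj : ∀ x ∈ X, (↑(Badx x) : Set β).PairwiseDisjoint (heal x))
    (hle : ∀ x ∈ X, ∀ b ∈ Badx x, a b ≤ q x * ∑ τ ∈ heal x b, a τ + r b) :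
    ∑ b ∈ Bad, a b ≤ (∑ x ∈ X, q x) * ∑ b ∈ T, a b + ∑ b ∈ Bad, r b := by
  -- the non-negative part of the corrected weight
  set a' : β → ℝ := fun b => max (a b - r b) 0 with ha'
  have ha'0 : ∀ b, 0 ≤ a' b := fun b => le_max_right _ _
  -- on `Bad`: `a ≤ a' + r`
  have hsplit : ∀ b ∈ Bad, a b ≤ a' b + r b := fun b _ => by
    have : a b - r b ≤ a' b := le_max_left _ _
    linarith
  -- `a'` obeys the PURE healing bound on every `Badx x`
  have hle' : ∀ x ∈ X, ∀ b ∈ Badx x, a' b ≤ q x * ∑ τ ∈ heal x b, a τ := fun x hx b hb =>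
    posPart_le_of_le_add (hq x hx) (Finset.sum_nonneg fun τ _ => ha τ) (hle x hx b hb)
  -- cover for `a'` with the `a`-weights on the right: per component, `Σ_{Badx x} a' ≤ q x · Σ_T a`
  have hx : ∀ x ∈ X, ∑ b ∈ Badx x, a' b ≤ q x * ∑ b ∈ T, a b := fun x hx =>
    calc ∑ b ∈ Badx x, a' b ≤ ∑ b ∈ Badx x, q x * ∑ τ ∈ heal x b, a τ := Finset.sum_le_sum (hle' x hx)
      _ = q x * ∑ τ ∈ (Badx x).biUnion (heal x), a τ := by rw [Finset.sum_biUnion (hdisj x hx), Finset.mul_sum]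
      _ ≤ q x * ∑ b ∈ T, a b :=
          mul_le_mul_of_nonneg_left
            (Finset.sum_le_sum_of_subset_of_nonneg (Finset.biUnion_subset.mpr (hmem x hx)) fun b _ _ => ha b)
            (hq x hx)
  calc ∑ b ∈ Bad, a b ≤ ∑ b ∈ Bad, (a' b + r b) := Finset.sum_le_sum hsplit
    _ = ∑ b ∈ Bad, a' b + ∑ b ∈ Bad, r b := Finset.sum_add_distrib
    _ ≤ ∑ b ∈ X.biUnion Badx, a' b + ∑ b ∈ Bad, r b :=
        add_le_add (Finset.sum_le_sum_of_subset_of_nonneg hcov fun b _ _ => ha'0 b) le_rfl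
    _ ≤ ∑ x ∈ X, ∑ b ∈ Badx x, a' b + ∑ b ∈ Bad, r b := add_le_add (sum_biUnion_le_sum X Badx ha'0) le_rfl
    _ ≤ ∑ x ∈ X, q x * ∑ b ∈ T, a b + ∑ b ∈ Bad, r b := add_le_add (Finset.sum_le_sum hx) le_rfl
    _ = (∑ x ∈ X, q x) * ∑ b ∈ T, a b + ∑ b ∈ Bad, r b := by rw [Finset.sum_mul]

end Heal

/-! ## §2 Healing laws with remainder for one run, and the END `RelWeightBound` with tolerance «healed + ρ» -/

section Laws

variable {ι α α' : Type*}

/-- **SET-VALUED HEALING LAWS WITH AN ADDITIVE REMAINDER for ONE run** (the hypothesis SHAPE of the refuter's F28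
re-cut; displayed, never asserted). As `HealingLawsSet` except: the pointwise-in-the-exterior healing comparison holds
only up to a remainder, `A K t τ ≤ q K x·Σ_{τ' ∈ heal K x τ} A K t τ' + rem K t τ` (`rem K t τ` = the part of the bad term's
weight carried by the flux-COHERENT exteriors, not compared; no sign condition is needed), and the remainders' total
over the bad class is small RELATIVE to the total weight: `Σ_{τ ∈ Bad K t} rem K t τ ≤ ρ K·Σ_{τ ∈ T K} A K t τ` with
`ρ K ≥ 0` (the large-deviation bound for coherent flux; for probability-normalised weights, `Σ_T A = 1`, this is
«`Σ_{Bad K} r ≤ ρ K`»). [folklore] -/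
structure HealingLawsSetR (l₀ : ℝ) (T : ℕ → Finset ι) (A : ℕ → ℝ → ι → ℝ) (Bad : ℕ → ℝ → Finset ι)
    (X : ℕ → Finset α) (Badx : ℕ → α → Finset ι) (heal : ℕ → α → ι → Finset ι) (q : ℕ → α → ℝ)
    (rem : ℕ → ℝ → ι → ℝ) (ρ : ℕ → ℝ) : Prop where
  /-- the bad class consists of terms -/
  bad_subset : ∀ K t, |t| ≤ l₀ → Bad K t ⊆ T K
  /-- every bad term contains some pinned old component -/
  cover : ∀ K t, |t| ≤ l₀ → ∀ τ ∈ Bad K t, ∃ x ∈ X K, τ ∈ Badx K x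
  /-- the healing class of a bad term consists of terms -/
  heal_subset : ∀ K, ∀ x ∈ X K, ∀ τ ∈ Badx K x, heal K x τ ⊆ T K
  /-- the healing classes of the bad terms of ONE pinned component are pairwise disjoint -/
  heal_disjoint : ∀ K, ∀ x ∈ X K, (↑(Badx K x) : Set ι).PairwiseDisjoint (heal K x)
  /-- the quotients are non-negative -/
  q_nonneg : ∀ K, ∀ x ∈ X K, 0 ≤ q K x
  /-- the quotient bound UP TO A REMAINDER, uniformly in the source -/
  le_heal : ∀ K t, |t| ≤ l₀ → ∀ x ∈ X K, ∀ τ ∈ Badx K x,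
    A K t τ ≤ q K x * ∑ τ' ∈ heal K x τ, A K t τ' + rem K t τ
  /-- the large-deviation budget is non-negative -/
  rho_nonneg : ∀ K, 0 ≤ ρ K
  /-- the remainders' total over the bad class is at most `ρ K` times the total weight -/
  sum_rem_le : ∀ K t, |t| ≤ l₀ → ∑ τ ∈ Bad K t, rem K t τ ≤ ρ K * ∑ τ ∈ T K, A K t τ

variable {l₀ : ℝ} {T : ℕ → Finset ι} {A B : ℕ → ℝ → ι → ℝ} {Bad : ℕ → ℝ → Finset ι}
  {X : ℕ → Finset α} {Badx : ℕ → α → Finset ι} {heal : ℕ → α → ι → Finset ι} {q : ℕ → α → ℝ}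
  {rem : ℕ → ℝ → ι → ℝ} {ρ : ℕ → ℝ}
  {X' : ℕ → Finset α'} {Badx' : ℕ → α' → Finset ι} {heal' : ℕ → α' → ι → Finset ι} {q' : ℕ → α' → ℝ}
  {rem' : ℕ → ℝ → ι → ℝ} {ρ' : ℕ → ℝ}

/-- Zero remainder: every `HealingLawsSet` witness is a `HealingLawsSetR` witness with `rem = 0`, `ρ = 0`. [folklore] -/
theorem HealingLawsSetR.ofSet (h : HealingLawsSet l₀ T A Bad X Badx heal q) :
    HealingLawsSetR l₀ T A Bad X Badx heal q (fun _ _ _ => 0) (fun _ => 0) where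
  bad_subset := h.bad_subset
  cover := h.cover
  heal_subset := h.heal_subset
  heal_disjoint := h.heal_disjoint
  q_nonneg := h.q_nonneg
  le_heal K t ht x hx τ hτ := by simpa using h.le_heal K t ht x hx τ hτ
  rho_nonneg _ := le_rfl
  sum_rem_le K t _ := by simp

/-- **ONE RUN**: healing laws with remainder + non-negative weights ⟹ the bad class has relative weight
`≤ Σ_{x ∈ X K} q K x + ρ K` at every cutoff and every `|t| ≤ l₀`. [folklore] -/
theorem HealingLawsSetR.bad_le (h : HealingLawsSetR l₀ T A Bad X Badx heal q rem ρ)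
    (hA : ∀ K t, |t| ≤ l₀ → ∀ τ, 0 ≤ A K t τ) (K : ℕ) (t : ℝ) (ht : |t| ≤ l₀) :
    ∑ τ ∈ Bad K t, A K t τ ≤ (∑ x ∈ X K, q K x + ρ K) * ∑ τ ∈ T K, A K t τ := by
  classical
  have hcov : Bad K t ⊆ (X K).biUnion (Badx K) := fun τ hτ => Finset.mem_biUnion.mpr (h.cover K t ht τ hτ)
  have h1 := sum_le_sum_mul_sum_add_of_healSets (X K) (Badx K) (heal K) (q K) (hA K t ht) hcov (h.q_nonneg K)
    (h.heal_subset K) (h.heal_disjoint K) (h.le_heal K t ht)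
  have h2 := h.sum_rem_le K t ht
  rw [add_mul]
  linarith

/-- The total tolerance is non-negative. [folklore] -/
theorem HealingLawsSetR.sum_q_add_nonneg (h : HealingLawsSetR l₀ T A Bad X Badx heal q rem ρ) (K : ℕ) :
    0 ≤ ∑ x ∈ X K, q K x + ρ K :=
  add_nonneg (Finset.sum_nonneg (h.q_nonneg K)) (h.rho_nonneg K)

/-- **THE END WITH REMAINDERS: two runs' healing laws with remainder ⟹ NE7b's output shape `RelWeightBound`.** Common
source-free term sets and bad classes, non-negative weights, and a common majorant `W` of BOTH runs' total tolerances
`Σ_x q K x + ρ K` (resp. `Σ_x q' K x + ρ' K`) from `K₀` on, with `W K < 1` there and `Σ W < ∞` ⟹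
`T4WeightBudget.RelWeightBound` with the bad classes emptied below `K₀` (`relWeightBound_of_eventually` BY NAME).
[folklore] -/
theorem relWeightBound_of_healingSetR {K₀ : ℕ} {W : ℕ → ℝ}
    (hA : HealingLawsSetR l₀ T A Bad X Badx heal q rem ρ) (hB : HealingLawsSetR l₀ T B Bad X' Badx' heal' q' rem' ρ')
    (hA0 : ∀ K t, |t| ≤ l₀ → ∀ τ, 0 ≤ A K t τ) (hB0 : ∀ K t, |t| ≤ l₀ → ∀ τ, 0 ≤ B K t τ)
    (hWA : ∀ K, K₀ ≤ K → ∑ x ∈ X K, q K x + ρ K ≤ W K) (hWB : ∀ K, K₀ ≤ K → ∑ x ∈ X' K, q' K x + ρ' K ≤ W K)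
    (h1 : ∀ K, K₀ ≤ K → W K < 1) (hs : Summable W) :
    RelWeightBound l₀ T A B (fun K t => if K₀ ≤ K then Bad K t else ∅) (Set.indicator {K | K₀ ≤ K} W) :=
  relWeightBound_of_eventually (fun K t ht _ => hA.bad_subset K t ht)
    (fun K hK => (hA.sum_q_add_nonneg K).trans (hWA K hK)) h1 hs
    (fun K t ht hK => (hA.bad_le hA0 K t ht).trans
      (mul_le_mul_of_nonneg_right (hWA K hK) (Finset.sum_nonneg fun τ _ => hA0 K t ht τ)))
    (fun K t ht hK => (hB.bad_le hB0 K t ht).trans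
      (mul_le_mul_of_nonneg_right (hWB K hK) (Finset.sum_nonneg fun τ _ => hB0 K t ht τ)))

/-- **H6-GLUE WITH REMAINDERS: the two-rate majorant for the healed part PLUS a summable large-deviation budget ⟹
`RelWeightBound` from SOME `K₀` on, tolerance «Λσ-term + ρ».** If both runs' quotient totals are `≤ V·r^{K − j⋆(K)}`
(`0 < r < 1`, `0 ≤ V`, `c·K ≤ K − j⋆(K)`, `0 < c`) and both large-deviation budgets are bounded by ONE summable `ρ₀`
(non-negative automatically, as `ρ ≥ 0`), then with `W K := V·r^{K − j⋆(K)} + ρ₀ K` (summable, eventually `< 1`) some `K₀` gives the `RelWeightBound`.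
[folklore] -/
theorem exists_relWeightBound_of_healingSetR_majorant {r V c : ℝ} {jstar : ℕ → ℕ} {ρ₀ : ℕ → ℝ}
    (hA : HealingLawsSetR l₀ T A Bad X Badx heal q rem ρ) (hB : HealingLawsSetR l₀ T B Bad X' Badx' heal' q' rem' ρ')
    (hA0 : ∀ K t, |t| ≤ l₀ → ∀ τ, 0 ≤ A K t τ) (hB0 : ∀ K t, |t| ≤ l₀ → ∀ τ, 0 ≤ B K t τ)
    (h0 : 0 < r) (hr1 : r < 1) (hV : 0 ≤ V) (hc : 0 < c)
    (hfrac : ∀ K : ℕ, c * K ≤ ((K - jstar K : ℕ) : ℝ))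
    (hmajA : ∀ K, ∑ x ∈ X K, q K x ≤ V * r ^ (K - jstar K))
    (hmajB : ∀ K, ∑ x ∈ X' K, q' K x ≤ V * r ^ (K - jstar K))
    (hρs : Summable ρ₀) (hρA : ∀ K, ρ K ≤ ρ₀ K) (hρB : ∀ K, ρ' K ≤ ρ₀ K) :
    ∃ K₀ : ℕ, RelWeightBound l₀ T A B (fun K t => if K₀ ≤ K then Bad K t else ∅)
      (Set.indicator {K | K₀ ≤ K} fun K => V * r ^ (K - jstar K) + ρ₀ K) := by
  -- both summands are eventually `< 1/2`
  have hmaj := eventually_weightMajorant_lt h0 hr1 hV hc (by norm_num : (0 : ℝ) < 1 / 2) hfrac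
  have hrho : ∀ᶠ K in Filter.atTop, ρ₀ K < 1 / 2 :=
    hρs.tendsto_atTop_zero.eventually (gt_mem_nhds (by norm_num : (0 : ℝ) < 1 / 2))
  obtain ⟨K₀, hK₀⟩ := Filter.eventually_atTop.mp (hmaj.and hrho)
  refine ⟨K₀, relWeightBound_of_healingSetR hA hB hA0 hB0 (fun K _ => add_le_add (hmajA K) (hρA K))
    (fun K _ => add_le_add (hmajB K) (hρB K)) (fun K hK => ?_) ((summable_weightMajorant h0 hr1 hV hc hfrac).add hρs)⟩
  have h := hK₀ K hK
  linarith [h.1, h.2]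

/-- Consistency: with zero remainders the END of `HealingMapClassFibred` is recovered (tolerance `V·r^{K−j⋆} + 0`). -/
example {r V c : ℝ} {jstar : ℕ → ℕ}
    (hA : HealingLawsSet l₀ T A Bad X Badx heal q) (hB : HealingLawsSet l₀ T B Bad X' Badx' heal' q')
    (hA0 : ∀ K t, |t| ≤ l₀ → ∀ τ, 0 ≤ A K t τ) (hB0 : ∀ K t, |t| ≤ l₀ → ∀ τ, 0 ≤ B K t τ)
    (h0 : 0 < r) (hr1 : r < 1) (hV : 0 ≤ V) (hc : 0 < c)
    (hfrac : ∀ K : ℕ, c * K ≤ ((K - jstar K : ℕ) : ℝ))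
    (hmajA : ∀ K, ∑ x ∈ X K, q K x ≤ V * r ^ (K - jstar K))
    (hmajB : ∀ K, ∑ x ∈ X' K, q' K x ≤ V * r ^ (K - jstar K)) :
    ∃ K₀ : ℕ, RelWeightBound l₀ T A B (fun K t => if K₀ ≤ K then Bad K t else ∅)
      (Set.indicator {K | K₀ ≤ K} fun K => V * r ^ (K - jstar K) + 0) :=
  exists_relWeightBound_of_healingSetR_majorant (HealingLawsSetR.ofSet hA) (HealingLawsSetR.ofSet hB) hA0 hB0 h0 hr1
    hV hc hfrac hmajA hmajB summable_zero (fun _ => le_rfl) (fun _ => le_rfl)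

end Laws

/-! ## §3 The END with remainders AND the position-fibred count (F20b + F28 together) -/

section End

variable {ι α α' π π' : Type*} [DecidableEq π] [DecidableEq π']
  {l₀ : ℝ} {T : ℕ → Finset ι} {A B : ℕ → ℝ → ι → ℝ} {Bad : ℕ → ℝ → Finset ι}
  {X : ℕ → Finset α} {Badx : ℕ → α → Finset ι} {heal : ℕ → α → ι → Finset ι} {q : ℕ → α → ℝ}
  {rem : ℕ → ℝ → ι → ℝ} {ρ : ℕ → ℝ}
  {X' : ℕ → Finset α'} {Badx' : ℕ → α' → Finset ι} {heal' : ℕ → α' → ι → Finset ι} {q' : ℕ → α' → ℝ}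
  {rem' : ℕ → ℝ → ι → ℝ} {ρ' : ℕ → ℝ}

/-- **KERNEL END OF THE (R-top) + F28 CUT WITH AN EXPLICIT WEIGHT**: two runs' set-valued healing laws WITH REMAINDER;
per run, birth scales `< j⋆(K)`, birth POSITIONS counted by `vol·Λ^{K−j}`, quotients of the components born at scale `j`
and position `y` summing to `≤ σ^{K−j}` (`HealingMapClassFibred.sum_le_twoRate_majorant_fibred` BY NAME); `vol, Λ, σ ≥ 0`,
`0 < Λσ < 1`, `j⋆(K) ≤ K`, `c·K ≤ K − j⋆(K)`; and ONE summable large-deviation budget `ρ₀ ≥ ρ, ρ'`. THEN some `K₀` gives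
`T4WeightBudget.RelWeightBound` with the tolerance `vol·(Λσ∕(1−Λσ))·(Λσ)^{K−j⋆(K)} + ρ₀ K`. [folklore] -/
theorem exists_relWeightBound_of_healingSetR_countFibred {birth : ℕ → α → ℕ} {birth' : ℕ → α' → ℕ}
    {pos : ℕ → α → π} {pos' : ℕ → α' → π'} {jstar : ℕ → ℕ} {vol Λ σ c : ℝ} {ρ₀ : ℕ → ℝ}
    (hA : HealingLawsSetR l₀ T A Bad X Badx heal q rem ρ) (hB : HealingLawsSetR l₀ T B Bad X' Badx' heal' q' rem' ρ')
    (hA0 : ∀ K t, |t| ≤ l₀ → ∀ τ, 0 ≤ A K t τ) (hB0 : ∀ K t, |t| ≤ l₀ → ∀ τ, 0 ≤ B K t τ)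
    (hvol : 0 ≤ vol) (hΛ : 0 ≤ Λ) (hσ : 0 ≤ σ) (hr0 : 0 < Λ * σ) (hr1 : Λ * σ < 1) (hc : 0 < c)
    (hjK : ∀ K, jstar K ≤ K) (hfrac : ∀ K : ℕ, c * K ≤ ((K - jstar K : ℕ) : ℝ))
    (hbirthA : ∀ K, ∀ x ∈ X K, birth K x < jstar K)
    (hcountA : ∀ K j, j < jstar K →
      ((((X K).filter fun x => birth K x = j).image (pos K)).card : ℝ) ≤ vol * Λ ^ (K - j))
    (hqA : ∀ K j y, ∑ x ∈ ((X K).filter fun x => birth K x = j).filter (fun x => pos K x = y), q K x ≤ σ ^ (K - j))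
    (hbirthB : ∀ K, ∀ x ∈ X' K, birth' K x < jstar K)
    (hcountB : ∀ K j, j < jstar K →
      ((((X' K).filter fun x => birth' K x = j).image (pos' K)).card : ℝ) ≤ vol * Λ ^ (K - j))
    (hqB : ∀ K j y,
      ∑ x ∈ ((X' K).filter fun x => birth' K x = j).filter (fun x => pos' K x = y), q' K x ≤ σ ^ (K - j))
    (hρs : Summable ρ₀) (hρA : ∀ K, ρ K ≤ ρ₀ K) (hρB : ∀ K, ρ' K ≤ ρ₀ K) :
    ∃ K₀ : ℕ, RelWeightBound l₀ T A B (fun K t => if K₀ ≤ K then Bad K t else ∅)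
      (Set.indicator {K | K₀ ≤ K} fun K => vol * (Λ * σ / (1 - Λ * σ)) * (Λ * σ) ^ (K - jstar K) + ρ₀ K) :=
  exists_relWeightBound_of_healingSetR_majorant hA hB hA0 hB0 hr0 hr1
    (mul_nonneg hvol (div_nonneg hr0.le (by linarith))) hc hfrac
    (fun K => sum_le_twoRate_majorant_fibred (X K) (q K) (birth K) (pos K) hvol hΛ hσ hr1 (hjK K) (hbirthA K)
      (hcountA K) (hqA K))
    (fun K => sum_le_twoRate_majorant_fibred (X' K) (q' K) (birth' K) (pos' K) hvol hΛ hσ hr1 (hjK K) (hbirthB K)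
      (hcountB K) (hqB K))
    hρs hρA hρB

end End

end Summit.QuantumFields.BalabanUV.T4Continuum.NE7b.HealingMapClass
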